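import Literature.AlgebraicGeometry.Morphisms.CechModuleH2CoverIndependence
import Literature.AlgebraicGeometry.Morphisms.CechModuleCoverIndependence
import Literature.AlgebraicGeometry.Morphisms.CechH1PreimageGluing
import Literature.AlgebraicGeometry.Morphisms.UnitIsoOver
import HarnessLib

/-!
# Transfer of the vanishing of `Ȟ²` along a morphism which is an isomorphism over an open
# containing the pairwise intersections of the cover

The degree-`2` Čech-to-derived obstruction, in the tree's elementary Čech vocabulary
(`Morphisms/CechModule`, `CechModuleH2`): let `r : S′ → X` be a morphism of separated `A`-schemes,
`𝒰 = (U_i)` a family of AFFINE opens covering `X`, and `Ω ⊆ X` an open containing `U_i ∩ U_j`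
for all `i ≠ j` over which `r` is an isomorphism (typically `Ω = X ∖ F` for a finite set `F` of
closed points each lying in exactly one `U_i`, and `r` a blow-up with centre supported on `F`).
For an affine-localizing (quasi-coherent) `𝒪_{S′}`-module `N` suppose

* (H1) for every `i`, some family of affine opens of `S′` with union `r⁻¹U_i` has every Čech
  `1`-cocycle of `N` a coboundary ("`H¹(r⁻¹U_i, N) = 0`"; automatic when `U_i ⊆ Ω`, for then
  `r⁻¹U_i ≅ U_i` is affine: `exists_affine_family_cechMZ1_le_of_le`), and
* (H2) every Čech `2`-cocycle of `N` on every family of affine opens covering `S′` is a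
  `2`-coboundary ("`H²(S′, N) = 0`", e.g. `S′` projective over a Noetherian local ring with closed
  fibre of dimension `≤ 1`, `Morphisms/CechH2FibreDimOneProjective`).

Then:

* `cechMZ2_le_cechMB2_preimageFamily_of_isIso_off` — **every Čech `2`-cocycle of `N` on the
  preimage family `(r⁻¹U_i)_i` is a `2`-coboundary** (although the `r⁻¹U_i` are not affine).
  Proof: the double complex of two coverings in degree `2` (`cechMZ2_le_cechMB2_of_two_covers`,
  `Morphisms/CechModuleH2TwoCovers`, Görtz–Wedhorn II Thm. 22.9) applied to the family `𝒱` of ALL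
  affine opens of `S′` subordinate to `(r⁻¹U_i)_i` and to `(r⁻¹U_i)_i`: the pieces `V ∩ r⁻¹U_i`
  are affine because `r⁻¹(U_{i₀} ∩ U_i) ≅ U_{i₀} ∩ U_i` is affine for `i ≠ i₀`; the row and
  column vanishings on the affine `V`, `V ∩ V′` are Görtz–Wedhorn II Lemma 22.1 in degrees `1, 2`
  (`CechModuleAffine`, `CechModuleH2CoverIndependence`); the column vanishing on `r⁻¹U_i` is (H1)
  moved to the family `(V_j ∩ r⁻¹U_i)_j` by cover independence in degree `1`
  (`cechMZ1_le_cechMB1_of_iSup_eq`, from `CechModuleCoverIndependence`); the vanishing on `𝒱` is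
  (H2).  This is the statement "`E₂^{0,1} = ⊕_i H¹(r⁻¹U_i, N) = 0` and `H²(S′, N) = 0` force
  `Ȟ²((r⁻¹U_i), N) = 0`" of the Čech-to-derived spectral sequence (The Stacks Project, Tag 01ET;
  Godement II.5.9), proved here without spectral sequences.
* `subsingleton_cechMH2_pushforward_of_isIso_off` — hence **`Ȟ²(𝒰, r_* N) = 0`**
  (`Č•(𝒰, r_*N) = Č•((r⁻¹U_i), N)`, `Morphisms/CechModuleUnit`, `CechH1PreimageGluing`).
* `cechMZ1_le_cechMB1_of_iSup_eq` — cover independence of "`Ȟ¹ = 0`" for two families of affine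
  opens with the SAME UNION (any union, not only `X`), for affine-localizing modules
  (Hartshorne III Thm. 4.5, degree `1`; from the refinement lemmas of `CechModuleCoverIndependence`).

Role (route (δ) «domination + divisorial twist» for the W4.4 door `NoZeno.GWH2ResolutionDim2`,
res-hironaka [INPUTS] 2026-08-28): `r : S′ → X` the dominating blow-up of a resolution
`X → Spec A` (Stacks 081T, `Morphisms/NagataCompactificationProofs.exists_isBlowup_dominating`)
with centre a finite set `F` of closed points, `N` a Serre twist of `r^* M` killing `H¹` on the
`r⁻¹U_i` meeting `F`; combined with `Morphisms/CechModuleH2IsoTransfer` along the unit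
`M → r_* r^* M` this yields `Ȟ²(𝒰, M) = 0`.  `GWH2ProperBirationalDim2` (non-regular `X`) and the
general Görtz–Wedhorn II Cor. 24.44 are NOT reached by this.  Everything is proved; no named facts;
no definitions.  Mathlib searched (pin v4.32): `Scheme.isBasis_affineOpens`, `Opens.isBasis_iff_nbhd`,
`Scheme.Hom.preimage_iSup`, `IsAffineOpen.inf` (used); no Čech cohomology of schemes in Mathlib.

## References

* U. Görtz, T. Wedhorn, *Algebraic Geometry II: Cohomology of Schemes*, Springer Spektrum (2023):
  Lemma 22.1 (p. 327), Thm. 22.9 (p. 332), Cor. 21.81 (p. 265). [GortzWedhorn2023]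
* R. Hartshorne, *Algebraic Geometry*, GTM 52 (1977): III Lemma 4.4, Thm. 4.5 (p. 222), III
  Ex. 4.11 (Čech cohomology of a cover with acyclic finite intersections). [Hartshorne1977]
* The Stacks Project, Tags 01ED (Čech complex), 01ET/01EV (Čech-to-cohomology spectral sequence),
  01XD. [StacksProject]
-/

noncomputable section

-- `TopCat.Presheaf`/`TopCat.Sheaf` are not reducible (as in Mathlib's `AlgebraicGeometry/Modules`).
set_option backward.isDefEq.respectTransparency false

open CategoryTheory AlgebraicGeometry Limits TopologicalSpace Opposite
open Literature.AlgebraicGeometry.Modules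

universe u v w

namespace Literature.AlgebraicGeometry.Morphisms

/-! ## Cover independence of `Ȟ¹ = 0` for affine families with the same union -/

section DegreeOne

variable {A : Type u} [CommRing A] {Y : Scheme.{u}} (g : Y ⟶ Spec (.of A)) {N : Y.Modules}
  (hN : IsAffineLocalizing N)

include hN in
/-- **Cover independence of the vanishing of `Ȟ¹`, relative form**: for `N` affine-localizing,
`𝒯 = (T_t)` a family of AFFINE opens and `𝒯′` any family of opens with the same union
`⋃ T_t = ⋃ T′_{t′}`, if every Čech `1`-cocycle of `N` on `𝒯` is a coboundary then so is every
`1`-cocycle on `𝒯′` (through the common refinement `(T_t ∩ T′_{t′})`: surjectivity from the affine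
family, injectivity back; Hartshorne III Thm. 4.5 in degree `1`, Görtz–Wedhorn II Cor. 21.81 with
Lemma 22.1). [cite: Hartshorne1977, III Thm. 4.5 p. 222 (cover independence, degree 1)] -/
theorem cechMZ1_le_cechMB1_of_iSup_eq {κ : Type v} {κ' : Type w} (T : κ → Y.Opens)
    (T' : κ' → Y.Opens) (hT : ∀ t, IsAffineOpen (T t)) (hTT' : ⨆ t, T t = ⨆ t', T' t')
    (h : cechMZ1 g N T ≤ cechMB1 g N T) : cechMZ1 g N T' ≤ cechMB1 g N T' := by
  let R : κ × κ' → Y.Opens := fun p => T p.1 ⊓ T' p.2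
  have hRT : ∀ t, T t ≤ ⨆ p, R p := by
    intro t
    have h1 : T t ≤ ⨆ t', T t ⊓ T' t' := by
      rw [← inf_iSup_eq, ← hTT']
      exact le_inf le_rfl (le_iSup T t)
    exact h1.trans (iSup_le fun t' => le_iSup R (t, t'))
  have hRT' : ∀ t', T' t' ≤ ⨆ p, R p := by
    intro t'
    have h1 : T' t' ≤ ⨆ t, T t ⊓ T' t' := by
      rw [← iSup_inf_eq, hTT']
      exact le_inf (le_iSup T' t') le_rfl
    exact h1.trans (iSup_le fun t => le_iSup R (t, t'))
  exact cechMZ1_le_cechMB1_of_refine' g T' R Prod.snd (fun p => inf_le_right) hRT'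
    (cechMZ1_le_cechMB1_of_refine g hN T R Prod.fst (fun p => inf_le_left) hT hRT h)

end DegreeOne

/-! ## Transfer along `r : S′ → X`, an isomorphism over `Ω ⊇ U_i ∩ U_j` (`i ≠ j`) -/

section Transfer

variable {A : Type u} [CommRing A] {X S' : Scheme.{u}} (f : X ⟶ Spec (.of A))
  (fS : S' ⟶ Spec (.of A)) (r : S' ⟶ X) [X.IsSeparated] [S'.IsSeparated]
  {ι : Type u} (U : ι → X.Opens) (hUaff : ∀ i, IsAffineOpen (U i)) (hcov : ⨆ i, U i = ⊤)
  (Ω : X.Opens) (hΩ : ∀ i j, i ≠ j → U i ⊓ U j ≤ Ω) [IsIso (r ∣_ Ω)]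
  {N : S'.Modules} (hN : IsAffineLocalizing N)

include hUaff hN in
omit [X.IsSeparated] [S'.IsSeparated] in
/-- (H1) holds for the members over which `r` is an isomorphism: if `U_i ⊆ Ω` then
`r⁻¹U_i ≅ U_i` is affine and the one-member family `(r⁻¹U_i)` has every `1`-cocycle of `N` a
coboundary. [cite: GortzWedhorn2023, Lemma 22.1 (p. 327)] -/
theorem exists_affine_family_cechMZ1_le_of_le (i : ι) (hi : U i ≤ Ω) :
    ∃ (κ : Type u) (T : κ → S'.Opens), (∀ t, IsAffineOpen (T t)) ∧
      ⨆ t, T t = r ⁻¹ᵁ U i ∧ cechMZ1 fS N T ≤ cechMB1 fS N T := by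
  haveI := isIso_morphismRestrict_of_le r hi
  have haff : IsAffineOpen (r ⁻¹ᵁ U i) :=
    isAffineOpen_preimage_of_isIso_morphismRestrict r (hUaff i)
  refine ⟨PUnit, fun _ => r ⁻¹ᵁ U i, fun _ => haff, iSup_const, ?_⟩
  exact cechMZ1_le_cechMB1_of_isAffineOpen fS hN haff (fun _ : PUnit.{u + 1} => r ⁻¹ᵁ U i)
    iSup_const

include hUaff hcov hΩ hN in
/-- **Transfer of `Ȟ² = 0` to the preimage family along a morphism which is an isomorphism over
`Ω ⊇ U_i ∩ U_j` (`i ≠ j`)**: `X`, `S′` separated, `U_i` affine covering `X`, `r : S′ → X` an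
isomorphism over `Ω`, `N` affine-localizing on `S′` with (H1) `H¹(r⁻¹U_i, N) = 0` for every `i` (for
SOME family of affine opens with union `r⁻¹U_i`) and (H2) `H²(S′, N) = 0` on every family of affine
opens covering `S′` — then every Čech `2`-cocycle of `N` on `(r⁻¹U_i)_i` is a `2`-coboundary.
[cite: GortzWedhorn2023, Thm. 22.9 (p. 332): degree 2, two-coverings form] -/
theorem cechMZ2_le_cechMB2_preimageFamily_of_isIso_off
    (h1 : ∀ i, ∃ (κ : Type u) (T : κ → S'.Opens), (∀ t, IsAffineOpen (T t)) ∧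
      ⨆ t, T t = r ⁻¹ᵁ U i ∧ cechMZ1 fS N T ≤ cechMB1 fS N T)
    (h2 : ∀ (κ : Type u) (T : κ → S'.Opens), (∀ t, IsAffineOpen (T t)) → ⨆ t, T t = ⊤ →
      cechMZ2 fS N T ≤ cechMB2 fS N T) :
    cechMZ2 fS N (preimageFamily r U) ≤ cechMB2 fS N (preimageFamily r U) := by
  classical
  -- the preimage family covers `S'`
  have hW : ⨆ i, r ⁻¹ᵁ U i = ⊤ := by
    rw [← Scheme.Hom.preimage_iSup, hcov]
    rfl
  -- the family of all affine opens subordinate to `(r⁻¹U_i)_i`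
  let J : Type u := Σ i : ι, {V : S'.affineOpens // (V : S'.Opens) ≤ r ⁻¹ᵁ U i}
  let 𝒱 : J → S'.Opens := fun j => (j.2.1 : S'.Opens)
  have h𝒱aff : ∀ j, IsAffineOpen (𝒱 j) := fun j => j.2.1.2
  have h𝒱le : ∀ j : J, 𝒱 j ≤ r ⁻¹ᵁ U j.1 := fun j => j.2.2
  have h𝒱cov : ⨆ j, 𝒱 j = ⊤ := by
    refine top_le_iff.mp fun p _ => ?_
    have hp : p ∈ ⨆ i, r ⁻¹ᵁ U i := by rw [hW]; trivial
    obtain ⟨i, hpi⟩ := Opens.mem_iSup.mp hp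
    obtain ⟨V, hV, hpV, hVle⟩ := (Opens.isBasis_iff_nbhd.mp S'.isBasis_affineOpens) hpi
    exact Opens.mem_iSup.mpr ⟨⟨i, ⟨⟨V, hV⟩, hVle⟩⟩, hpV⟩
  -- the mixed pieces are affine
  have hWW : ∀ i i', i ≠ i' → IsAffineOpen (r ⁻¹ᵁ (U i ⊓ U i')) := by
    intro i i' h
    haveI := isIso_morphismRestrict_of_le r (hΩ i i' h)
    exact isAffineOpen_preimage_of_isIso_morphismRestrict r ((hUaff i).inf (hUaff i'))
  have hpiece : ∀ (j : J) (i : ι), IsAffineOpen (𝒱 j ⊓ r ⁻¹ᵁ U i) := by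
    intro j i
    by_cases h : j.1 = i
    · subst h
      rw [inf_eq_left.mpr (h𝒱le j)]
      exact h𝒱aff j
    · have e : 𝒱 j ⊓ r ⁻¹ᵁ U i = 𝒱 j ⊓ r ⁻¹ᵁ (U j.1 ⊓ U i) :=
        le_antisymm (le_inf inf_le_left (le_inf (inf_le_left.trans (h𝒱le j)) inf_le_right))
          (le_inf inf_le_left (inf_le_right.trans (inf_le_right : r ⁻¹ᵁ U j.1 ⊓ r ⁻¹ᵁ U i ≤ _)))
      rw [e]
      exact (h𝒱aff j).inf (hWW j.1 i h)
  -- the double complex of the two coverings `𝒱`, `(r⁻¹U_i)`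
  refine cechMZ2_le_cechMB2_of_two_covers fS N 𝒱 (preimageFamily r U)
    (fun j => (h𝒱le j).trans (le_iSup (fun i => r ⁻¹ᵁ U i) j.1))
    (fun i => by rw [h𝒱cov]; exact le_top) (fun j => ?_) (fun j j' => ?_) (fun i => ?_)
    (h2 J 𝒱 h𝒱aff h𝒱cov)
  · -- rows: `Ȟ²` of the affine `V_j` on the affine pieces `V_j ∩ r⁻¹U_i`
    refine cechMZ2_le_cechMB2_of_isAffineOpen fS hN (h𝒱aff j) (fun i => 𝒱 j ⊓ r ⁻¹ᵁ U i)
      (hpiece j) ?_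
    rw [← inf_iSup_eq, hW, inf_top_eq]
  · -- rows: `Ȟ¹` of the affine `V_j ∩ V_{j'}`
    refine cechMZ1_le_cechMB1_of_isAffineOpen fS hN ((h𝒱aff j).inf (h𝒱aff j'))
      (fun i => 𝒱 j ⊓ 𝒱 j' ⊓ r ⁻¹ᵁ U i) ?_
    rw [← inf_iSup_eq, hW, inf_top_eq]
  · -- columns: `Ȟ¹` of `r⁻¹U_i` on `(V_j ∩ r⁻¹U_i)_j`, from (H1) by cover independence
    obtain ⟨κ, T, hTaff, hTcov, hT⟩ := h1 i
    refine cechMZ1_le_cechMB1_of_iSup_eq fS hN T (fun j => 𝒱 j ⊓ r ⁻¹ᵁ U i) hTaff ?_ hT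
    rw [hTcov, ← iSup_inf_eq, h𝒱cov, top_inf_eq]

include hUaff hcov hΩ hN in
/-- **`Ȟ²(𝒰, r_* N) = 0`** under the same hypotheses: `X`, `S′` separated `A`-schemes, `𝒰` a
family of affine opens covering `X`, `r : S′ → X` over `Spec A` an isomorphism over
`Ω ⊇ U_i ∩ U_j` (`i ≠ j`), `N` affine-localizing with `H¹(r⁻¹U_i, N) = 0` for all `i` (H1) and
`H²(S′, N) = 0` on affine covers (H2).  (`Č•(𝒰, r_*N) = Č•((r⁻¹U_i)_i, N)`.)
[cite: GortzWedhorn2023, Thm. 22.9 (p. 332): degree 2, two-coverings form] -/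
theorem subsingleton_cechMH2_pushforward_of_isIso_off (hr : r ≫ f = fS)
    (h1 : ∀ i, ∃ (κ : Type u) (T : κ → S'.Opens), (∀ t, IsAffineOpen (T t)) ∧
      ⨆ t, T t = r ⁻¹ᵁ U i ∧ cechMZ1 fS N T ≤ cechMB1 fS N T)
    (h2 : ∀ (κ : Type u) (T : κ → S'.Opens), (∀ t, IsAffineOpen (T t)) → ⨆ t, T t = ⊤ →
      cechMZ2 fS N T ≤ cechMB2 fS N T) :
    Subsingleton (CechMH2 f ((Scheme.Modules.pushforward r).obj N) U) := by
  rw [subsingleton_cechMH2_iff]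
  intro e he
  have hle := cechMZ2_le_cechMB2_preimageFamily_of_isIso_off fS r U hUaff hcov Ω hΩ hN h1 h2
  have hz := (mem_cechMZ2_pushforwardEquiv_iff f U fS r hr N e).mpr he
  exact (mem_cechMB2_pushforwardEquiv_iff f U fS r hr N e).mp (hle hz)

end Transfer

end Literature.AlgebraicGeometry.Morphisms

end
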